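import Mathlib
import HarnessLib
import Summits.HubbardSuperconductivity.HubbardSuperconductivity.Theses.ComplexGFFStiffness
import Summits.HubbardSuperconductivity.HubbardSuperconductivity.Theorems.ComplexGFFStiffnessTwoKernelNextKStepLoc
import Summits.HubbardSuperconductivity.HubbardSuperconductivity.Theorems.ComplexGFFStiffnessTwoKernelSkBoundRawReduction
import Summits.HubbardSuperconductivity.HubbardSuperconductivity.Theorems.ComplexGFFStiffnessTwoKernelSkBoundFarField
import Summits.HubbardSuperconductivity.HubbardSuperconductivity.Theorems.ComplexGFFStiffnessF4l2ShrinkLocOfBlockB4Stub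
import Summits.HubbardSuperconductivity.HubbardSuperconductivity.Theorems.ComplexGFFStiffnessF4l2BlockB4

/-!
# Route `route-HubbardSuperconductivity-ComplexGFFStiffness`: the crux child `TwoKernelSkBound`
# (stmt-HubbardSuperconductivity-27414) HOLDS — `GradientRG.TwoKernelSkBound 4 ∧ GradientRG.F4l2Shrink 4`

The registered skeleton `Cruxes/HypACumulant/Lines/banach_two_kernel.lean` (line `banach_two_kernel`, v3) with every stub replaced by its
landed theorem: `stub_twoKernelNextKStepLoc` (p830855), `stub_twoKernelSkBoundLoc_of_raw` (p827477), `stub_twoKernelSkBound_of_loc` and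
`stub_f4l2Shrink_of_loc` (p826914), `stub_f4l2ShrinkLoc_of_blockB4` (p834050) and `stub_blockB4` (this generation,
`ComplexGFFStiffnessF4l2BlockB4`).  [ABKM19] Lemma 12.6 (12.53) at `ℓ = 1, 2` with `N`-FREE sizes: the two-kernel comparison of the
irrelevant RG step `S_k^{(q)}(u, v)` in the tuning parameter — first order at full radius (slot (F4l)) and the mixed second
`q`-differences for the shrunk package (slot (F4l2)).

* **`TwoKernelSkBound_proof`** — the route decl `Summit.….Theses.ComplexGFFStiffness.TwoKernelSkBound` BY NAME.

All proved, no `sorry`.  Honest scope: rung route H2gff / 1c (volume-uniform stiffness of a complex Gaussian gradient field via the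
[ABKM19] renormalisation group); nothing about superconductivity in the Hubbard model is claimed or advanced.

## References
* S. Adams, S. Buchholz, R. Kotecký, S. Müller, arXiv:1910.13564, Theorem 6.8, Lemma 8.4, Lemma 12.6 (12.53)
  [AdamsBuchholzKoteckyMuller2019].
-/

noncomputable section

-- `Summit.<Summit>.<Problem>`: single-conjunct summit, the duplicate component is mandated (D-0017).
set_option linter.dupNamespace false

namespace Summit.HubbardSuperconductivity.HubbardSuperconductivity.Theorems

open Literature.MathematicalPhysics.StatisticalMechanics.GradientRG

/-- **The crux child `TwoKernelSkBound` (stmt-HubbardSuperconductivity-27414) holds**: the `N`-free two-kernel `S_k` bundle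
[ABKM19] (12.53) at `ℓ = 1` (`TwoKernelSkBound 4`, full radius) and `ℓ = 2` (`F4l2Shrink 4`, shrunk package) — the composition of the
six landed stubs of the line `banach_two_kernel`. [cite: AdamsBuchholzKoteckyMuller2019, Lemma 12.6 (12.53) / Theorem 6.8 / Lemma 8.4] -/
theorem TwoKernelSkBound_proof :
    Summit.HubbardSuperconductivity.HubbardSuperconductivity.Theses.ComplexGFFStiffness.TwoKernelSkBound := by
  unfold Summit.HubbardSuperconductivity.HubbardSuperconductivity.Theses.ComplexGFFStiffness.TwoKernelSkBound
  have h₁ : TwoKernelSkBoundLoc 4 := ComplexGFF.stub_twoKernelSkBoundLoc_of_raw ComplexGFF.stub_twoKernelNextKStepLoc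
  have h₂ : F4l2ShrinkLoc 4 := ComplexGFF.stub_f4l2ShrinkLoc_of_blockB4 ComplexGFF.stub_blockB4
  have h₃ : TwoKernelSkBound 4 := ComplexGFF.stub_twoKernelSkBound_of_loc h₁
  exact ⟨h₃, ComplexGFF.stub_f4l2Shrink_of_loc h₃ h₂⟩

end Summit.HubbardSuperconductivity.HubbardSuperconductivity.Theorems

end
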